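import Literature.Barriers.Parity.LargeSieveLevelHalf
import Literature.NumberTheory.Sieve.LargeSieveCharacters
import HarnessLib

/-!
# Barrier catalogue `Parity`, entry `LargeSieveLevelHalf` — NARROWED (barrier audit, D-0021)

Topic `Literature/Barriers/Parity`. The catalogued record
`Literature.Barriers.Parity.LargeSieveLevelHalf` (Bombieri–Friedlander–Iwaniec 1986: "It is the
application of the large sieve inequality (1.6) that sets the limit `Q = x^{1/2}𝓛^{-B}`";
Montgomery 1978: both terms of `Q² + N − 1` are necessary) is TRUE — it is proved in the tree
(`LargeSieveLevelHalf_holds`) and it is a corollary of the present record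
(`LargeSieveLevelHalf_of_narrow`). What the 2026-08-16 audit narrows is the SCOPE its BARRIER
block claims. Two things are sharper than that block, and this file records them — one PROVED,
one from the post-2020 literature:

1. **The `Q²` of the large-sieve constant is paid by EVERY sequence once the moduli exceed the
   length — so beyond `x^{1/2}` nothing is lost in the large-sieve inequality itself.** The
   record's scope caveat (b) ("the proved necessity is worst-case over ALL sequences `a_n` … and
   says nothing about the special bilinear forms built from `Λ`") undersells the kernel. PROVED
   here: for a prime `p ≥ N` and every complex sequence on `(M, M + N]`, Parseval modulo `p`
   gives `∑_{b < p} |S(b/p)|² = p ∑|a_n|²` (`sum_range_norm_sq_eq`; `S(θ) = ∑_n a_n e(nθ)`), hence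
   `∑_{0 < b < p} |S(b/p)|² ≥ (p − N) ∑|a_n|²` (`sub_mul_le_sum_coprime_prime`: the term `b = 0` is
   `|∑ a_n|² ≤ N ∑|a_n|²`), and keeping only the prime moduli `p ≥ N`,
   `∑_{q ≤ Q} ∑_{(b,q)=1} |S(b/q)|² ≥ (∑_{p prime, N ≤ p ≤ Q} (p − N)) · ∑|a_n|²` for EVERY `a`
   (`primeSum_mul_le_largeSieveSum`, `primeSum_le_of_bound`). The prime sum is `∼ Q²/(2 log Q)`
   as soon as `Q/N → ∞` (Chebyshev, prime number theorem [cite: MontgomeryVaughan2007, Cor 2.6 and Thm 6.9]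
   — cited, not formalised), against the admissible `Q² + N − 1`. In the Bombieri–Vinogradov
   architecture at moduli `q ∼ Q > x^{1/2}` at least one factor of `α ⋆ β` (`MN = x`) has
   length `≤ x^{1/2} < Q`, and for the balanced shapes `M, N ≤ Q/2` (which (A₁) obliges a proof
   of the class to treat) BOTH factors' large-sieve sums are within `O(log Q)` of the bound
   `(Q² + ·)‖·‖²` whatever the coefficients are — pieces of `Λ`, of `μ`, or anything else; no
   restriction to "arithmetically nice" sequences can lower them. The `x^{1/2}` ceiling is
   therefore located one step UPSTREAM of (1.6): in bounding the character expansion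
   `Δ(x; q, a) = φ(q)⁻¹ ∑_{χ ≠ χ₀} χ̄(a) A(χ) B(χ)` by absolute values `φ(q)⁻¹ ∑_χ |A(χ)B(χ)|`
   — the step that makes `max_{(a,q)=1}` and the location of `ϑ` free — which per modulus
   forgoes the cancellation between different characters that alone can beat `x/q < x^{1/2}`.
   In print: extending (BV) to `q ≤ x^{1/2+ε}` "would imply some cancellation for sums over
   zeroes of different `L`-functions" [cite: Maynard2020LargeModuliI, §1 (paragraph after (1.2))]; "To break the
   `x^{1/2}`-barrier, we need to reduce the `Q²` in the upper bound in Lemma [the bilinear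
   large-sieve bound]. This term arises in the estimates that the number of terms in various
   arithmetic progressions is the length of that progression plus `O(1)`. The idea now is to be
   more precise about all those "`O(1)`"s by using Fourier analysis to obtain some cancellation.
   We will be able to do this when the residue classes `a_q` do not vary with `q`"
   [cite: GranvilleShao2019BeyondHalf, §7 (first paragraph)].
2. **`max_{(a,q)=1}` is NOT what is blocked beyond `x^{1/2}`.** The record's `evasions_known:`
   ends "with `max_{(a,q)=1}` retained, nothing beyond `Q = x^{1/2}𝓛^{-B}` is published", and
   its `because:` (with BFI's 1986 remark "the parameter `a` is now forced to be (more or less)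
   fixed") ties every evasion to a fixed residue. This is out of date: Maynard, *Primes in
   arithmetic progressions to large moduli III: Uniform residue classes* (Mem. AMS 1544, 2025)
   proves Bombieri–Vinogradov estimates at level `x^{1/2+δ}` with `sup_{(a,q)=1}` INSIDE the sum
   over moduli, for moduli `q = q₁q₂` with a factor `q₁ ∼ Q₁ ≤ x^{1/10−3δ}(log x)^{-C}`,
   `Q₂ ≤ x^{4/10+4δ}(log x)^C` (Theorem 1.1, weak saving `δπ(x) + x(log log x)²/(log x)²`), with
   saving `(log x)^{-A}` for triply factorable moduli at the price of fixing `a mod q₁q₂`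
   uniformly in `q₃` (Theorem 1.2), and with full uniformity and saving `(log x)^{-A}` for a prime
   minorant `ρ ≤ 1_ℙ`, `∑_{n ≤ x} ρ(n) ≥ π(x)/8`, at `q₁q₂ = x^{1/2+δ}`, `Q₁ ∈ [x^{2/5+5δ}, x^{3/7}]`
   (Theorem 1.3; hence "every primitive residue class contains at least one prime" for almost all
   such moduli, Corollary 1.4) [cite: Maynard2020LargeModuliIII, Theorems 1.1–1.3 and Corollary 1.4]. The dependence on `a`
   is a feature of ONE evasion: "Any method exploiting bounds for sums of Kloosterman sums via the
   spectral theory of automorphic forms necessarily introduces a dependence on the residue class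
   appearing, and this essentially restricts one to only considering the same residue class
   `a ≪ x^ε` for all moduli `q`", whereas Zhang "ultimately relied only on exponential sum
   estimates coming from algebraic geometry, which have the benefit of being much more uniform
   with respect to the residue classes" [cite: Maynard2020LargeModuliIII, §1].

What survives (CONFIRMED in print): the COMPLETE-family statement — all moduli `q ≤ x^{1/2+ε}`,
i.e. the tree's `Literature.NumberTheory.Sieve.PrimesHaveLevel θ` for `θ > 1/2`
(`sup_y sup_a`, every power of `log` saved), with or without the `sup_a` — is unpublished: "even
the result with `Q = x^{1/2}` has not yet been achieved" [cite: BombieriFriedlanderIwaniecActa1986, §1 (after (1.4))]; "it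
remains an important outstanding problem in analytic number theory just to extend the range of
moduli in (BV) to `q ≤ x^{1/2+ε}`, thereby going 'beyond the square-root barrier'"
[cite: Maynard2020LargeModuliI, §1 (paragraph after (1.2))]; over ALL moduli `q ∼ x^{1/2+δ}` only the weak saving
`δ² x/log x + x(log log x)^{O(1)}/(log x)³` for a fixed `a` is known (Bombieri–Friedlander–Iwaniec
II/III as restated in [cite: Maynard2020LargeModuliI, §1.1 Theorem 1]); every result with a log-power or better
saving beyond `x^{1/2}` restricts the moduli (smooth / conveniently factorable) or the weights
(well factorable) [cite: Maynard2020LargeModuliI, §1.1 (Theorems 1–3 and the comparison)].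

## What the sources print (verified on the page)

* E. Bombieri, J. B. Friedlander, H. Iwaniec, Acta Math. 156 (1986) [cite: BombieriFriedlanderIwaniecActa1986, §1 ((1.4)–(1.7))]:
  (1.4) with `Q = x^{1/2}𝓛^{-B}`; "It was conjectured by P. D. T. A. Elliott and H. Halberstam
  [3] that (1.4) may hold with `Q = x^{1−ε}` but even the result with `Q = x^{1/2}` has not yet
  been achieved"; (A₁), (A₂), (1.5), (1.6); "It is the application of the large sieve inequality
  (1.6) that sets the limit `Q = x^{1/2}𝓛^{-B}` and not the shape of the bilinear form `α ⋆ β`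
  … In these new arguments the parameter `a` is now forced to be (more or less) fixed so we
  must drop from both (1.5) and (1.4) the expression `max_{(a,q)=1}`. Since, in most
  applications of (1.4), `a` is fixed, this causes no great concern. More serious is the fact
  that, for these arguments, the location of `ϑ` does matter"; (1.7) "cannot yet be done".
* J. Maynard, *Primes in arithmetic progressions to large moduli I: Fixed residue classes*,
  arXiv:2006.06572 = Mem. AMS 1542 [cite: Maynard2020LargeModuliI, §1 and §1.1]: "it remains an important
  outstanding problem in analytic number theory just to extend the range of moduli in (1.2)
  [Bombieri–Vinogradov with `sup_{(a,q)=1}`] to `q ≤ x^{1/2+ε}`, thereby going 'beyond the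
  square-root barrier' and producing estimates which are not directly implied by the
  Generalized Riemann Hypothesis. By expanding the summand via Dirichlet characters and the
  explicit formula, we see that this would imply some cancellation for sums over zeroes of
  different `L`-functions"; "we will make use of estimates of Deshouillers–Iwaniec for sums of
  Kloosterman sums coming from the Kuznetsov trace formula which requires us to only consider
  the situation when `a` is fixed (or a small power of `x`)"; Theorem 1.1 (fixed `a ∈ ℤ`,
  `∑_{q₁ ≤ Q₁}∑_{q₂ ≤ Q₂} |π(x; q₁q₂, a) − π(x)/φ(q₁q₂)| ≪_{a,ε,A} x/(log x)^A` under
  `Q₁Q₂² < x^{1−100ε}`, `Q₁^{12}Q₂^7 < x^{4−100ε}`, `Q₁^{20}Q₂^{19} < x^{10−100ε}`);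
  Corollary 1.2 (moduli `q ≤ x^{1/2+δ}` with a divisor in `[x^{2δ+η}, min(x^{1/10−7δ/5−η},
  x^{1/2−19δ−η})]`), Corollary 1.3 ("all but at most `18δQφ(a)/a` moduli `q ∈ [Q, 2Q]`"),
  Corollary 1.4 (`q₁ ≤ x^{1/21}`, `q₂ ≤ x^{10/21−ε}`); §1.1 Theorem 1 (BFI II/III: `a ∈ ℤ`,
  `Q = x^{1/2+δ}`, `∑_{q ∈ [Q,2Q], (q,a)=1} |π(x;q,a) − π(x)/φ(q)| ≪_a δ² x/log x +
  x(log log x)^{O(1)}/(log x)³`), Theorem 2 (BFI I, well factorable, `Q < x^{4/7−ε}`), Theorem 3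
  (Zhang, Polymath: `a ∈ ℤ`, `0 < δ < 7/300`, `x^η`-smooth `q ≤ x^{1/2+δ}`); "The key
  qualitative features of Theorem 1.1 are that it gives good savings over the trivial bound for
  'most' moduli of size `x^{1/2+δ}` and treats the error terms with absolute values. This is the
  first such result."
* J. Maynard, *Primes in arithmetic progressions to large moduli III: Uniform residue classes*,
  arXiv:2006.08250 = Mem. AMS 1544 [cite: Maynard2020LargeModuliIII, Abstract, §1, Theorems 1.1–1.3, Corollary 1.4]: "The main
  feature of these estimates is that they are completely uniform with respect to the residue
  classes considered, unlike previous works on primes in arithmetic progressions to large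
  moduli"; Polymath's `sup_{a ∈ ℤ} ∑_{q ≤ x^{1/2+δ}, (q,a)=1, p | q ⇒ p ≤ x^δ} |π(x;q,a) − π(x)/φ(q)|
  ≪_A x/(log x)^A` "considers `exp(x^{δ+o(1)})` different residue classes in total"; Theorem 1.1:
  "Let `Q₁ ≤ x^{1/10−3δ}/(log x)^C` and `Q₂ ≤ x^{4/10+4δ}(log x)^C`. Then
  `∑_{Q₁ ≤ q₁ ≤ 2Q₁} ∑_{Q₂ ≤ q₂ ≤ 2Q₂} sup_{(a,q₁q₂)=1} |π(x; q₁q₂, a) − π(x)/φ(q₁q₂)| ≪_C δπ(x) +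
  x(log log x)²/(log x)²`" ("a version of a theorem of Bombieri–Friedlander–Iwaniec [BFI3]
  which is now completely uniform with respect to residue classes"); Theorem 1.2
  (`Q₁Q₂Q₃ = x^{1/2+δ}`, `0 < δ < 1/1000`,
  `∑_{q₁}∑_{q₂} sup_{(b,q₁q₂)=1} ∑_{q₃} sup_{(a,q₁q₂q₃)=1, a ≡ b (q₁q₂)} |…| ≪_{A,δ} x/(log x)^A`);
  Theorem 1.3 (minorant `ρ ≤ 1_ℙ`, `∑_{n ≤ x} ρ(n) ≥ π(x)/8`, `Q₁ ∈ [x^{2/5+5δ}, x^{3/7}]`,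
  `Q₂ = x^{1/2+δ}/Q₁`: `∑_{q₁ ≤ Q₁}∑_{q₂ ≤ Q₂} sup_{(a,q₁q₂)=1} |∑_{n ≡ a} ρ(n) − φ(q₁q₂)⁻¹∑_{(n,q₁q₂)=1} ρ(n)|
  ≪_{δ,A} x/(log x)^A`); Corollary 1.4 (primes in ALL primitive classes for almost all
  `q ≤ x^{1/2+δ}` with a divisor in `[x^{2/5+δ}, x^{3/7}]`).
* A. Granville, X. Shao, Adv. Math. 350 (2019), arXiv:1703.06865 [cite: GranvilleShao2019BeyondHalf, Abstract, §1.1 (1.2), §1.4 (Theorems 1.8–1.9), §7]: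
  "For a fixed residue class `a` we extend such averages out to moduli `≤ x^{20/39−δ}`";
  (1.2) `Δ(f,x;q,a) = φ(q)⁻¹ ∑_{χ ≠ χ₀} χ(a) S_f(x,χ)`; Green's
  `∑_{q ∼ Q prime} |Δ(f,x;q,1)| ≪ x log log x/(log x)²` for `Q < x^{20/39−ε}`, "remarkably
  breaking the `x^{1/2}`-barrier"; Theorems 1.8–1.9 ("for fixed `a`", `1 ≤ |a| ≪ Q ≤ x^{20/39−δ}`,
  via Bettin–Chandee's bilinear Kloosterman bound); §7 as quoted in item 1 above.
* H. L. Montgomery, R. C. Vaughan, *Multiplicative Number Theory I* (2007)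
  [cite: MontgomeryVaughan2007, Cor 2.6 and Thm 6.9]: `ϑ(x) ≍ x`, `π(x) ≍ x/log x` (Chebyshev); the
  prime number theorem with error term — whence `∑_{p ≤ Q} p ∼ Q²/(2 log Q)` by partial summation.

## What is NOT here

No statement that Cauchy–Schwarz between the two factors is tight for specific sequences
(`|A(χ)| ≈ ‖α‖` for most `χ` is the standard heuristic, not a theorem); no formalisation of the
multiplicative-character form of item 1 (for a prime `p > M` every `χ ≠ χ₀ mod p` is primitive and
`∑_{χ mod p} |A(χ)|² = (p − 1) ∑_{p ∤ m} |α_m|²`, the same computation); no formalisation of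
Maynard's theorems (they are cited as evasions, not vendored as facts: D-0026, one named
declaration per audit — the narrowed record itself).
-/

noncomputable section

open Finset Real Complex
open scoped ComplexConjugate FourierTransform

namespace Literature.Barriers.Parity

open Literature.NumberTheory.Sieve.LargeSieve (e e_sub sum_range_e_mul_div)

/-! ### Parseval modulo `q` and the every-sequence lower bound -/

/-- Orthogonality on an interval shorter than the modulus: for `q ≥ 1` and `n, m` in an interval
`(M, M + N]` with `N ≤ q`, `∑_{b < q} e(b(n − m)/q) = q·[n = m]` (the tree's
`LargeSieve.sum_range_e_mul_div` at `d = n − m`, `|d| < N ≤ q`). [folklore] -/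
theorem sum_range_e_sub_eq {q N : ℕ} (hq : 0 < q) (hN : N ≤ q) {M n m : ℤ}
    (hn : n ∈ Ioc M (M + N)) (hm : m ∈ Ioc M (M + N)) :
    ∑ b ∈ range q, e ((b : ℝ) * ((n - m : ℤ) : ℝ) / q) = if n = m then (q : ℂ) else 0 := by
  rw [mem_Ioc] at hn hm
  have hd : |n - m| < q := by
    rw [abs_lt]; constructor <;> omega
  rw [sum_range_e_mul_div hq hd]
  simp only [sub_eq_zero]

/-- **Parseval modulo `q` on an interval of length `N ≤ q`**: for EVERY complex sequence,
`∑_{b < q} |∑_{M<n≤M+N} a_n e(bn/q)|² = q ∑_{M<n≤M+N} |a_n|²` (expand the square and use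
orthogonality; the `n` are pairwise incongruent modulo `q`). [folklore] -/
theorem sum_range_norm_sq_eq {q N : ℕ} (hq : 0 < q) (hN : N ≤ q) (a : ℤ → ℂ) (M : ℤ) :
    ∑ b ∈ range q, ‖∑ n ∈ Ioc M (M + N), a n * (𝐞 ((b : ℝ) * n / q) : ℂ)‖ ^ 2 =
      (q : ℝ) * ∑ n ∈ Ioc M (M + N), ‖a n‖ ^ 2 := by
  set I := Ioc M (M + N) with hI
  have key : ((∑ b ∈ range q, ‖∑ n ∈ I, a n * e ((b : ℝ) * n / q)‖ ^ 2 : ℝ) : ℂ) =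
      (((q : ℝ) * ∑ n ∈ I, ‖a n‖ ^ 2 : ℝ) : ℂ) := by
    calc ((∑ b ∈ range q, ‖∑ n ∈ I, a n * e ((b : ℝ) * n / q)‖ ^ 2 : ℝ) : ℂ)
        = ∑ b ∈ range q, (∑ n ∈ I, a n * e ((b : ℝ) * n / q)) *
            conj (∑ m ∈ I, a m * e ((b : ℝ) * m / q)) := by
          push_cast
          refine sum_congr rfl fun b _ => ?_
          rw [Complex.mul_conj, Complex.normSq_eq_norm_sq]; push_cast; ring
      _ = ∑ b ∈ range q, ∑ n ∈ I, ∑ m ∈ I,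
            a n * conj (a m) * e ((b : ℝ) * ((n - m : ℤ) : ℝ) / q) := by
          refine sum_congr rfl fun b _ => ?_
          rw [map_sum, sum_mul_sum]
          refine sum_congr rfl fun n _ => sum_congr rfl fun m _ => ?_
          rw [map_mul, mul_mul_mul_comm, ← e_sub]
          congr 2
          push_cast
          ring
      _ = ∑ n ∈ I, ∑ m ∈ I, a n * conj (a m) *
            ∑ b ∈ range q, e ((b : ℝ) * ((n - m : ℤ) : ℝ) / q) := by
          rw [sum_comm]
          refine sum_congr rfl fun n _ => ?_
          rw [sum_comm]
          refine sum_congr rfl fun m _ => ?_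
          rw [mul_sum]
      _ = ∑ n ∈ I, a n * conj (a n) * (q : ℂ) := by
          refine sum_congr rfl fun n hn => ?_
          rw [sum_eq_single_of_mem n hn (fun m hm hmn => by
            rw [sum_range_e_sub_eq hq hN hn hm, if_neg (Ne.symm hmn), mul_zero])]
          rw [sum_range_e_sub_eq hq hN hn hn, if_pos rfl]
      _ = (((q : ℝ) * ∑ n ∈ I, ‖a n‖ ^ 2 : ℝ) : ℂ) := by
          push_cast
          rw [mul_sum]
          refine sum_congr rfl fun n _ => ?_
          rw [Complex.mul_conj, Complex.normSq_eq_norm_sq]; push_cast; ring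
  exact_mod_cast key

/-- For a prime `p`, the reduced residues in `range p` are the non-zero ones. [folklore] -/
theorem filter_coprime_range_prime {p : ℕ} (hp : p.Prime) :
    (range p).filter (fun b => b.Coprime p) = (range p).erase 0 := by
  ext b
  simp only [mem_filter, mem_range, mem_erase]
  constructor
  · rintro ⟨hb, hcop⟩
    refine ⟨?_, hb⟩
    rintro rfl
    rw [Nat.coprime_zero_left] at hcop
    exact hp.one_lt.ne' hcop
  · rintro ⟨hb0, hb⟩
    refine ⟨hb, ?_⟩
    rw [Nat.coprime_comm, hp.coprime_iff_not_dvd]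
    intro hdvd
    exact hb0 (Nat.eq_zero_of_dvd_of_lt hdvd hb)

/-- **Every sequence pays the modulus at a prime exceeding its length**: for a prime `p ≥ N`
and EVERY complex sequence on `(M, M + N]`,
`∑_{0 < b < p} |∑_n a_n e(bn/p)|² ≥ (p − N) ∑_n |a_n|²` — Parseval (`sum_range_norm_sq_eq`) minus
the term `b = 0`, which is `|∑ a_n|² ≤ N ∑|a_n|²` by Cauchy–Schwarz. Compare Montgomery's
worst-case examples behind `le_of_isLargeSieveConstant` / `totientSum_le_of_isLargeSieveConstant`
[cite: Montgomery1978, p. 548]. -/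
theorem sub_mul_le_sum_coprime_prime {p N : ℕ} (hp : p.Prime) (hN : N ≤ p) (a : ℤ → ℂ)
    (M : ℤ) :
    ((p : ℝ) - N) * ∑ n ∈ Ioc M (M + N), ‖a n‖ ^ 2 ≤
      ∑ b ∈ range p with b.Coprime p, ‖∑ n ∈ Ioc M (M + N), a n * (𝐞 ((b : ℝ) * n / p) : ℂ)‖ ^ 2 := by
  set I := Ioc M (M + N) with hI
  set f : ℕ → ℝ := fun b => ‖∑ n ∈ I, a n * (𝐞 ((b : ℝ) * n / p) : ℂ)‖ ^ 2 with hf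
  have hpars : ∑ b ∈ range p, f b = (p : ℝ) * ∑ n ∈ I, ‖a n‖ ^ 2 :=
    sum_range_norm_sq_eq hp.pos hN a M
  have h0 : (0 : ℕ) ∈ range p := mem_range.mpr hp.pos
  have hsplit : ∑ b ∈ range p, f b = f 0 + ∑ b ∈ (range p).erase 0, f b :=
    (add_sum_erase (range p) f h0).symm
  have hf0 : f 0 ≤ (N : ℝ) * ∑ n ∈ I, ‖a n‖ ^ 2 := by
    have h1 : f 0 = ‖∑ n ∈ I, a n‖ ^ 2 := by
      simp only [hf, Nat.cast_zero, zero_mul, zero_div]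
      congr 2
      refine sum_congr rfl fun n _ => ?_
      rw [AddChar.map_zero_eq_one]; simp
    rw [h1]
    have hcard : (#I : ℝ) = N := by
      have hN' : (M + N - M).toNat = N := by omega
      rw [hI, Int.card_Ioc, hN']
    calc ‖∑ n ∈ I, a n‖ ^ 2 ≤ (∑ n ∈ I, ‖a n‖) ^ 2 := by
          gcongr; exact norm_sum_le _ _
      _ ≤ #I * ∑ n ∈ I, ‖a n‖ ^ 2 := sq_sum_le_card_mul_sum_sq
      _ = (N : ℝ) * ∑ n ∈ I, ‖a n‖ ^ 2 := by rw [hcard]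
  rw [filter_coprime_range_prime hp]
  change ((p : ℝ) - N) * ∑ n ∈ I, ‖a n‖ ^ 2 ≤ ∑ b ∈ (range p).erase 0, f b
  have : ∑ b ∈ (range p).erase 0, f b = (p : ℝ) * ∑ n ∈ I, ‖a n‖ ^ 2 - f 0 := by linarith
  rw [this]
  nlinarith [hf0]

/-- **Every-sequence lower bound for the large-sieve sum of parity.S33**: for all `N, Q` and EVERY
complex sequence on `(M, M + N]`,
`∑_{q ≤ Q} ∑_{(b,q)=1} |∑_n a_n e(bn/q)|² ≥ (∑_{p prime, N ≤ p ≤ Q} (p − N)) · ∑_n |a_n|²`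
(keep only the prime moduli `p ≥ N`, apply `sub_mul_le_sum_coprime_prime`). The prime sum is
`∼ Q²/(2 log Q)` once `Q/N → ∞` [cite: MontgomeryVaughan2007, Cor 2.6 and Thm 6.9], against the admissible
`Q² + N − 1` (`isLargeSieveConstant_sq_add`): when the modulus range exceeds the length, the
large sieve inequality is sharp up to a factor `O(log Q)` for every single sequence, not only
in the worst case. -/
theorem primeSum_mul_le_largeSieveSum (N Q : ℕ) (a : ℤ → ℂ) (M : ℤ) :
    (∑ p ∈ (Icc 1 Q).filter (fun p => p.Prime ∧ N ≤ p), ((p : ℝ) - N)) *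
        ∑ n ∈ Ioc M (M + N), ‖a n‖ ^ 2 ≤
      ∑ q ∈ Icc 1 Q, ∑ b ∈ range q with b.Coprime q,
        ‖∑ n ∈ Ioc M (M + N), a n * (𝐞 ((b : ℝ) * n / q) : ℂ)‖ ^ 2 := by
  rw [sum_mul]
  calc ∑ p ∈ (Icc 1 Q).filter (fun p => p.Prime ∧ N ≤ p),
        ((p : ℝ) - N) * ∑ n ∈ Ioc M (M + N), ‖a n‖ ^ 2
      ≤ ∑ p ∈ (Icc 1 Q).filter (fun p => p.Prime ∧ N ≤ p), ∑ b ∈ range p with b.Coprime p,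
          ‖∑ n ∈ Ioc M (M + N), a n * (𝐞 ((b : ℝ) * n / p) : ℂ)‖ ^ 2 := by
        refine sum_le_sum fun p hp => ?_
        rw [mem_filter] at hp
        exact sub_mul_le_sum_coprime_prime hp.2.1 hp.2.2 a M
    _ ≤ ∑ q ∈ Icc 1 Q, ∑ b ∈ range q with b.Coprime q,
          ‖∑ n ∈ Ioc M (M + N), a n * (𝐞 ((b : ℝ) * n / q) : ℂ)‖ ^ 2 :=
        sum_le_sum_of_subset_of_nonneg (filter_subset _ _)
          fun q _ _ => sum_nonneg fun b _ => by positivity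

/-- The sequence-wise form: if `∑_{q ≤ Q} ∑_{(b,q)=1} |S(b/q)|² ≤ Δ ∑|a_n|²` holds for ONE
non-zero sequence `a` on `(M, M + N]`, then already `Δ ≥ ∑_{p prime, N ≤ p ≤ Q} (p − N)`.
[folklore] -/
theorem primeSum_le_of_bound {N Q : ℕ} {a : ℤ → ℂ} {M : ℤ} {Δ : ℝ}
    (ha : 0 < ∑ n ∈ Ioc M (M + N), ‖a n‖ ^ 2)
    (h : ∑ q ∈ Icc 1 Q, ∑ b ∈ range q with b.Coprime q,
        ‖∑ n ∈ Ioc M (M + N), a n * (𝐞 ((b : ℝ) * n / q) : ℂ)‖ ^ 2 ≤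
      Δ * ∑ n ∈ Ioc M (M + N), ‖a n‖ ^ 2) :
    ∑ p ∈ (Icc 1 Q).filter (fun p => p.Prime ∧ N ≤ p), ((p : ℝ) - N) ≤ Δ :=
  le_of_mul_le_mul_right ((primeSum_mul_le_largeSieveSum N Q a M).trans h) ha

/-! ### The narrowed barrier record -/

/-- **Barrier (narrowed): beyond `x^{1/2}` the large-sieve step of Bombieri–Vinogradov is
lossless for EVERY sequence — the limit `Q = x^{1/2}` sits in the absolute-value character
expansion over the COMPLETE family of moduli, and `max_{(a,q)=1}` is not what is blocked.**
PROVED below (`LargeSieveLevelHalfNarrow_holds`): for `N, Q ≥ 1`, (i) `Q² + N − 1` is an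
admissible large-sieve constant, (ii) every admissible `Δ` has `N ≤ Δ` and `Q²/4 ≤ Δ`
(Montgomery's worst-case examples — the content of `LargeSieveLevelHalf`), and (iii) for EVERY
non-zero complex sequence `a` on `(M, M + N]`, any `Δ` with
`∑_{q ≤ Q} ∑_{(b,q)=1} |∑_n a_n e(bn/q)|² ≤ Δ ∑|a_n|²` already satisfies
`Δ ≥ ∑_{p prime, N ≤ p ≤ Q} (p − N)` (`∼ Q²/(2 log Q)` when `Q/N → ∞`).

BARRIER
technique_class: large-sieve mean-value bombieri-vinogradov level-of-distribution character-expansion — proofs of mean-value theorems `∑_{q ≤ Q} (max_{(a,q)=1}) |Δ_f(x;q,a)|` for `f = Λ` or for convolutions `α ⋆ β` under (A₁) (`M = x^{1−ϑ}`, `N = x^ϑ`, `ε ≤ ϑ ≤ 1 − ε`) and (A₂) (Siegel–Walfisz for `β`) that expand the class `a mod q` in Dirichlet characters (equivalently in the additive harmonics `b/q`, `(b,q) = 1`) over the COMPLETE family of moduli `q ≤ Q` and bound the expansion `Δ(x;q,a) = φ(q)⁻¹∑_{χ ≠ χ₀} χ̄(a)A(χ)B(χ)` in ABSOLUTE VALUE,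 `φ(q)⁻¹∑_χ|A(χ)||B(χ)|`, before a mean-value inequality for the family is applied — the large sieve (1.6) = parity.S33 `Literature.NumberTheory.Sieve.large_sieve_inequality` with any admissible constant (`IsLargeSieveConstant N Q Δ`; bilinear form `Literature.NumberTheory.Sieve.LargeSieve.largeSieve_bilinear`), or any sharpening of it valid only for special coefficient sequences [cite: BombieriFriedlanderIwaniecActa1986, §1 ((A₁), (A₂), (1.5), (1.6))] [cite: GranvilleShao2019BeyondHalf, §1.1 (1.2) and §7 (first paragraph)].
blocks: by this architecture, `Literature.NumberTheory.Sieve.PrimesHaveLevel θ` for `θ > 1/2` (ALL moduli `q ≤ x^{θ−ε}`, `sup_y sup_{(a,q)=1}`; hence `Literature.NumberTheory.Sieve.LevelOfDistribution.ElliottHalberstam`, beyond the known `Literature.NumberTheory.Sieve.BombieriVinogradovStatement`) and, equally, its fixed-residue analogue over all moduli: for `Q ≥ 2 max(M, N)` — in particular for the balanced shapes `M = N = x^{1/2}` that (A₁) obliges such a proof to treat once `Q > 2x^{1/2}` — a factor of length `L ≤ Q/2` has large-sieve sum `≥ (∑_{L ≤ p ≤ Q}(p − L))‖·‖² ≍ Q²‖·‖²/log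 Q` WHATEVER its coefficients (`primeSum_mul_le_largeSieveSum`, `primeSum_le_of_bound`; [cite: MontgomeryVaughan2007, Cor 2.6 and Thm 6.9] for the size of the prime sum), so Cauchy–Schwarz over `(q, χ)` followed by ANY valid upper bound for the two large-sieve sums certifies nothing better than `≍ Q‖α‖‖β‖/log Q` for `∑_{q ∼ Q} φ(q)⁻¹∑_χ|A(χ)B(χ)|`, which exceeds the target `‖α‖‖β‖x^{1/2}𝓛^{-A}` of (1.5) as soon as `Q > x^{1/2}𝓛^{A}`: "It is the application of the large sieve inequality (1.6) that sets the limit `Q = x^{1/2}𝓛^{-B}` and not the shape of the bilinear form `α ⋆ β`" [cite: BombieriFriedlanderIwaniecActa1986, §1 (paragraph after (1.6))], sharpened to: not the inequality's worst case but the absolute values taken before it — beyond `x^{1/2}` one needs "some cancellation for sums over zeroes of different `L`-functions" [cite: Maynard2020LargeModuliI, §1 (paragraph after (1.2))]; the full-family statement is not in print: "even the result with `Q = x^{1/2}` has not yet been achieved" [cite: BombieriFriedlanderIwaniecActa1986, §1 (after (1.4))]; extending the range of moduli in (BV) "to `q ≤ x^{1/2+ε}`" would be "going 'beyond the square-root barrier'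 and producing estimates which are not directly implied by the Generalized Riemann Hypothesis" [cite: Maynard2020LargeModuliI, §1 (paragraph after (1.2))].
because: PROVED (`LargeSieveLevelHalfNarrow_holds`): (i)–(ii) are `LargeSieveLevelHalf_holds` (Selberg's constant; Montgomery's constant and one-term sequences, `Δ ≥ N`, `Δ ≥ ∑_{q ≤ Q}φ(q) ≥ Q²/4`) [cite: Montgomery1978, p. 548 and Thm 3]; (iii) for a prime `p ≥ N`, Parseval modulo `p` on an interval of length `N` — the `n` are pairwise incongruent — gives `∑_{b < p}|S(b/p)|² = p∑|a_n|²` for every sequence (`sum_range_norm_sq_eq`), the term `b = 0` is `|∑a_n|² ≤ N∑|a_n|²` (Cauchy–Schwarz), so `∑_{0<b<p}|S(b/p)|² ≥ (p − N)∑|a_n|²` (`sub_mul_le_sum_coprime_prime`), and the moduli `q ≤ Q` contain the primes `N ≤ p ≤ Q` (`primeSum_mul_le_largeSieveSum`); hence within the class the `Q²` contribution is incurred by the ACTUAL coefficients (pieces of `Λ`, `μ`, smooth weights — anything), and what is lost beyond `x^{1/2}` is the cancellation among characters discarded by the absolute values: "To break the `x^{1/2}`-barrier, we need to reduce the `Q²`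 in the upper bound … This term arises in the estimates that the number of terms in various arithmetic progressions is the length of that progression plus `O(1)`. The idea now is to be more precise about all those '`O(1)`'s by using Fourier analysis to obtain some cancellation" [cite: GranvilleShao2019BeyondHalf, §7 (first paragraph)].
evasions_known: (a) produce the cancellation between harmonics by the dispersion method + Fourier analysis + Kloosterman sums (spectral theory), for a FIXED residue `a` and structured weights/moduli: bilinear ranges and well-factorable level `x^{4/7−ε}` [cite: BombieriFriedlanderIwaniecActa1986, §1 (Theorems 8–10)], `x^{3/5−ε}` (triply well factorable) and `x^{7/12−ε}` (linear-sieve weights) [cite: Maynard2020LargeModuliII, Theorems 1.1–1.2], absolute values over moduli `q ≤ x^{1/2+δ}` with a conveniently sized factor, up to `x^{11/21−ε}`, "the first such result" for 'most' moduli [cite: Maynard2020LargeModuliI, Theorem 1.1, Corollaries 1.2–1.4 and §1.1], level `x^{20/39−δ}` for bounded multiplicative `f` and fixed `a` (Green for prime moduli; Bettin–Chandee bilinear Kloosterman bound) [cite: GranvilleShao2019BeyondHalf, Abstract and §1.4 (Theorems 1.8–1.9)]; the `a`-dependence here is intrinsic to the spectral input ("Any method exploiting bounds for sums of Kloosterman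 sums via the spectral theory of automorphic forms necessarily introduces a dependence on the residue class") [cite: Maynard2020LargeModuliIII, §1]; (b) AUDIT — `sup_a` RETAINED beyond `x^{1/2}`: algebraic-geometry exponential sums are `a`-uniform — Zhang / Polymath (smooth moduli `q ≤ x^{1/2+δ}`, `a` fixed across `q` but `sup_{a ∈ ℤ}` outside the sum; `θ = 1/2 + 7/300`) [cite: Polymath8a2014, Theorem 1.1] [cite: Maynard2020LargeModuliIII, §1], and Maynard III with `sup_{(a,q)=1}` INSIDE: `∑_{q₁ ∼ Q₁}∑_{q₂ ∼ Q₂} sup_{(a,q₁q₂)=1}|π(x;q₁q₂,a) − π(x)/φ(q₁q₂)| ≪ δπ(x) + x(log log x)²/(log x)²` for `Q₁ ≤ x^{1/10−3δ}(log x)^{-C}`, `Q₂ ≤ x^{4/10+4δ}(log x)^C` (Theorem 1.1), saving `(log x)^{-A}` for triply factorable `q₁q₂q₃ = x^{1/2+δ}` with `a mod q₁q₂` fixed uniformly in `q₃` (Theorem 1.2), full `sup_a` with saving `(log x)^{-A}` for a prime minorant `ρ`, `∑ρ ≥ π(x)/8`, `q₁q₂ = x^{1/2+δ}`, `Q₁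 ∈ [x^{2/5+5δ}, x^{3/7}]` (Theorem 1.3), primes in every primitive class for almost all such moduli (Corollary 1.4) [cite: Maynard2020LargeModuliIII, Theorems 1.1–1.3 and Corollary 1.4]; (c) over ALL moduli `q ∼ x^{1/2+δ}` with absolute values: only the weak saving `δ²x/log x + x(log log x)^{O(1)}/(log x)³`, fixed `a` (BFI II/III) [cite: Maynard2020LargeModuliI, §1.1 Theorem 1] — every log-power saving beyond `x^{1/2}` in print restricts the moduli (smooth / factorable) or the weights (well factorable) [cite: Maynard2020LargeModuliI, §1.1 (Theorems 1–3 and the comparison)].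
scope_caveats: (a) "sets the limit" remains a diagnosis of an ARCHITECTURE; no theorem says (1.4) fails for `x^{1/2} < Q ≤ x^{1−ε}` — that range is the Elliott–Halberstam hypothesis `Literature.NumberTheory.Sieve.LevelOfDistribution.ElliottHalberstam` ("(1.4) may hold with `Q = x^{1−ε}`") [cite: BombieriFriedlanderIwaniecActa1986, §1 (after (1.4))], refuted only at `Q = x(log x)^{-B}` (tree `FriedlanderGranvilleUniformity.lean`, `EquidistributionLimits.lean`); (b) the every-sequence sharpness (iii) is proved at PRIME moduli `p ≥ N` in the additive (Farey) form of parity.S33 only; the evaluation `∑_{N ≤ p ≤ Q}(p − N) ∼ Q²/(2 log Q)` (`Q/N → ∞`) is Chebyshev / the prime number theorem, cited not formalised [cite: MontgomeryVaughan2007, Cor 2.6 and Thm 6.9]; the multiplicative form (1.6) is the same computation (for a prime `p > M` every `χ ≠ χ₀` is primitive and `∑_{χ mod p}|A(χ)|² = (p−1)∑_{p∤m}|α_m|²`) but is not formalised here; (c) that Cauchy–Schwarz between the factors is itself tight (`|A(χ)| ≈ ‖α‖` for most `χ`, so `φ(q)⁻¹∑_χ|A(χ)B(χ)| ≍ ‖α‖‖β‖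 ≍ x^{1/2}` per modulus against the target `x/(q𝓛^A)`) is the standard heuristic behind "not directly implied by the Generalized Riemann Hypothesis … cancellation for sums over zeroes of different `L`-functions" [cite: Maynard2020LargeModuliI, §1 (paragraph after (1.2))] — NOT a theorem for specific sequences, so for a factor LONGER than `Q` nothing rigorous is asserted; (d) the `sup_a`-uniform evasions (b) cover factorable / smooth moduli only — for one dyadic factor range a positive but not full proportion of `q ≤ x^{1/2+δ}` — and Theorem 1.1's saving is `O(δ) + (log log x)²/(log x)²`, not `(log x)^{-A}` [cite: Maynard2020LargeModuliIII, Theorem 1.1 and the paragraph following it]; (e) sieve applications to shifted primes `p + h` need only the fixed class `−h mod d` ("Since, in most applications of (1.4), `a` is fixed, this causes no great concern") [cite: BombieriFriedlanderIwaniecActa1986, §1 (paragraph after (1.6))], where evasions (a) apply; (f) as in the original record, the entry concerns the distribution INPUT only: even level `1` leaves the binary Hardy–Littlewood asymptotics to parity (tree `SelbergParity.lean`, `PrimePairParity.lean`, `FordMaynardPrimeSieves.lean`).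
status: established — PROVED (`LargeSieveLevelHalfNarrow_holds`; it implies the original record, `LargeSieveLevelHalf_of_narrow`); the literature narrowing (evasion (b)) is [cite: Maynard2020LargeModuliIII, Theorems 1.1–1.3]. -/
def LargeSieveLevelHalfNarrow : Prop :=
  ∀ N Q : ℕ, 1 ≤ N → 1 ≤ Q →
    IsLargeSieveConstant N Q ((Q : ℝ) ^ 2 + N - 1) ∧
    (∀ Δ : ℝ, IsLargeSieveConstant N Q Δ → (N : ℝ) ≤ Δ ∧ (Q : ℝ) ^ 2 / 4 ≤ Δ) ∧
    ∀ (a : ℤ → ℂ) (M : ℤ) (Δ : ℝ), 0 < ∑ n ∈ Ioc M (M + N), ‖a n‖ ^ 2 →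
      (∑ q ∈ Icc 1 Q, ∑ b ∈ range q with b.Coprime q,
          ‖∑ n ∈ Ioc M (M + N), a n * (𝐞 ((b : ℝ) * n / q) : ℂ)‖ ^ 2 ≤
        Δ * ∑ n ∈ Ioc M (M + N), ‖a n‖ ^ 2) →
      ∑ p ∈ (Icc 1 Q).filter (fun p => p.Prime ∧ N ≤ p), ((p : ℝ) - N) ≤ Δ

/-- **Proof of the narrowed record `LargeSieveLevelHalfNarrow`.** (i)–(ii): the original record
`LargeSieveLevelHalf_holds` [cite: Montgomery1978, p. 548 and Thm 3]; (iii): `primeSum_le_of_bound`. -/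
theorem LargeSieveLevelHalfNarrow_holds : LargeSieveLevelHalfNarrow := fun N Q hN hQ =>
  ⟨(LargeSieveLevelHalf_holds N Q hN hQ).1, (LargeSieveLevelHalf_holds N Q hN hQ).2,
    fun _ _ _ ha h => primeSum_le_of_bound ha h⟩

/-- The narrowed record implies the catalogued one (it contains it as conjuncts (i)–(ii)).
[cite: Montgomery1978, p. 548] -/
theorem LargeSieveLevelHalf_of_narrow (h : LargeSieveLevelHalfNarrow) : LargeSieveLevelHalf :=
  fun N Q hN hQ => ⟨(h N Q hN hQ).1, (h N Q hN hQ).2.1⟩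

/-- **The every-sequence constant is genuinely of size `Q²/log Q`: a decidable instance.** At
`N = 4`, `Q = 30` the sequence-wise necessary constant is at least
`∑_{4 ≤ p ≤ 30}(p − 4) = (5+7+11+13+17+19+23+29) − 8·4 = 92`, for EVERY non-zero sequence of
length `4` — against the worst-case necessary `max(N, Q²/4) = 225` and the admissible
`Q² + N − 1 = 903`. [folklore] -/
theorem primeSum_four_thirty :
    ∑ p ∈ (Icc (1 : ℕ) 30).filter (fun p : ℕ => p.Prime ∧ 4 ≤ p), ((p : ℝ) - 4) = 92 := by
  have hS : (Icc (1 : ℕ) 30).filter (fun p : ℕ => p.Prime ∧ 4 ≤ p) =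
      {5, 7, 11, 13, 17, 19, 23, 29} := by
    decide
  rw [hS]
  norm_num

end Literature.Barriers.Parity
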